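import Literature.Analysis.Fourier.LaplaceSchwartz
import HarnessLib

/-!
# The multiplier `4 sin²(πr²/2)` on Schwartz space

Cohn–Kumar–Miller–Radchenko–Viazovska, arXiv:1902.05438, §5.1 (5.2)–(5.3): the pieces of `F₂` are
`4 sin²(πr²/2)` times Gaussian–Laplace transforms. Since
`4 sin²(πr²/2) = 2 − e^{iπr²} − e^{−iπr²}` has temperate growth, multiplication by it preserves the
Schwartz class. PROVED here: `hasTemperateGrowth_fourSinSq`, the continuous linear map
`fourSinSqCLM : 𝓢(ℝ,ℂ) →L[ℂ] 𝓢(ℝ,ℂ)` with `fourSinSqCLM f r = 4 sin²(πr²/2) f(r)`, and, for a Laplace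
weight `K` on `I`, the Schwartz function `r ↦ 4 sin²(πr²/2) ∫_I K(t)e^{−πr²t}dt`
(`LaplaceWeight.fourSinSqLaplace`, the shape of `F_{2,low}`, `F_{2,trunc}` in (5.3)).

## References

* H. Cohn, A. Kumar, S. D. Miller, D. Radchenko, M. Viazovska, Ann. of Math. 196 (2022),
  arXiv:1902.05438, §5.1 (5.2), (5.3). [CohnEtAl2019]
-/

noncomputable section

open scoped SchwartzMap Topology ContDiff
open Filter Complex MeasureTheory Set Real

namespace Literature.Analysis.Fourier

/-- `4 sin²(πr²/2)` as a complex-valued function of `r ∈ ℝ`. [cite: CohnEtAl2019, §5.1 (5.2)] -/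
def fourSinSq (r : ℝ) : ℂ := (4 * Real.sin (Real.pi * r ^ 2 / 2) ^ 2 : ℝ)

/-- `4 sin²(πr²/2) = 2 − e^{iπr²} − e^{−iπr²}`. [folklore] -/
theorem fourSinSq_eq (r : ℝ) :
    fourSinSq r = 2 - cexp (((Real.pi * ‖r‖ ^ 2 : ℝ) : ℂ) * I) - cexp (((-Real.pi * ‖r‖ ^ 2 : ℝ) : ℂ) * I) := by
  have hn : ‖r‖ ^ 2 = r ^ 2 := by rw [Real.norm_eq_abs, sq_abs]
  rw [fourSinSq, hn]
  -- `4 sin²(x/2) = 2 − 2cos x = 2 − e^{ix} − e^{−ix}`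
  have h1 : (4 * Real.sin (Real.pi * r ^ 2 / 2) ^ 2 : ℝ) = 2 - 2 * Real.cos (Real.pi * r ^ 2) := by
    have A := Real.cos_two_mul (Real.pi * r ^ 2 / 2)
    rw [show 2 * (Real.pi * r ^ 2 / 2) = Real.pi * r ^ 2 by ring] at A
    have B := Real.sin_sq_add_cos_sq (Real.pi * r ^ 2 / 2)
    linear_combination 4 * B + 2 * A
  rw [h1]
  push_cast
  have h2 : Complex.cos (↑Real.pi * (↑r : ℂ) ^ 2) = (cexp (↑Real.pi * (↑r : ℂ) ^ 2 * I) + cexp (-(↑Real.pi * (↑r : ℂ) ^ 2) * I)) / 2 := by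
    rw [Complex.cos]
  rw [h2]
  ring

/-- **`4 sin²(πr²/2)` has temperate growth.** [cite: CohnEtAl2019, §5.1] -/
theorem hasTemperateGrowth_fourSinSq : Function.HasTemperateGrowth fourSinSq := by
  have h : fourSinSq = fun r : ℝ => (2 : ℂ) - cexp (((Real.pi * ‖r‖ ^ 2 : ℝ) : ℂ) * I) - cexp (((-Real.pi * ‖r‖ ^ 2 : ℝ) : ℂ) * I) :=
    funext fourSinSq_eq
  rw [h]
  exact ((Function.HasTemperateGrowth.const (2 : ℂ)).sub (hasTemperateGrowth_cexp_mul_norm_sq_mul_I (E := ℝ) Real.pi)).sub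
    (hasTemperateGrowth_cexp_mul_norm_sq_mul_I (E := ℝ) (-Real.pi))

/-- Multiplication by `4 sin²(πr²/2)` on `𝓢(ℝ,ℂ)`. [cite: CohnEtAl2019, §5.1 (5.3)] -/
def fourSinSqCLM : 𝓢(ℝ, ℂ) →L[ℂ] 𝓢(ℝ, ℂ) := SchwartzMap.smulLeftCLM ℂ fourSinSq

/-- `fourSinSqCLM_apply` (auxiliary). [cite: CohnEtAl2019, §5.1 (5.3)] -/
@[simp] theorem fourSinSqCLM_apply (f : 𝓢(ℝ, ℂ)) (r : ℝ) : fourSinSqCLM f r = fourSinSq r * f r := by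
  rw [fourSinSqCLM, SchwartzMap.smulLeftCLM_apply hasTemperateGrowth_fourSinSq]
  rfl

namespace LaplaceWeight

variable {K : ℝ → ℂ} {I : Set ℝ}

/-- **`r ↦ 4 sin²(πr²/2) ∫_I K(t) e^{−πr²t} dt` is a Schwartz function** (the shape of `F_{2,low}` and
`F_{2,trunc}` in (5.3)). [cite: CohnEtAl2019, §5.1 (5.3)] -/
def fourSinSqLaplace (h : LaplaceWeight K I) : 𝓢(ℝ, ℂ) := fourSinSqCLM h.laplaceGaussSchwartz

/-- `fourSinSqLaplace_apply` (auxiliary). [cite: CohnEtAl2019, §5.1 (5.3)] -/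
theorem fourSinSqLaplace_apply (h : LaplaceWeight K I) (r : ℝ) :
    h.fourSinSqLaplace r = fourSinSq r * ∫ t in I, K t * (Real.exp (-Real.pi * r ^ 2 * t) : ℂ) := by
  rw [fourSinSqLaplace, fourSinSqCLM_apply, laplaceGaussSchwartz_apply]

end LaplaceWeight

end Literature.Analysis.Fourier
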